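import Literature.Computability.AlgebraicComplexity.AlperBogartVelascoBoxFour
import HarnessLib

/-!
# Route `SymPencil` — `7`-dimensional linear subspaces of `Sing Z(per_4)`, II: a full row forces a cross
# (`--supports` stmt-ValiantsHypothesis-5674 `SdcSuperquadratic`; towards the sizes `m = 21, 22`)

Canonical position (the full row is row `3`).  Let `W` be a `7`-dimensional space of `4 × 4`
matrices on which all `3 × 3` minor-permanents vanish, such that row `3` maps `W` ONTO `K⁴` and
`W` contains, for each `a ∈ {0, 1, 2}`, a non-zero matrix `z_a` supported in row `a` (this is the
profile `(1,1,1,4)` of `SymPencilBoxFourSevenFiltration.filtration_seven`).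

* `exists_common_column`: the three `z_a` are supported in one and the same column `k` — the
  cubic on the rows `(a, b, 3)` of `α z_a + β z_b + x_t` (`row_3 x_t = t` arbitrary) kills all
  pairings `p_l q_{l'} + p_{l'} q_l` of `p = row_a z_a`, `q = row_b z_b`; three pairwise "unpaired"
  non-zero vectors of `K⁴` are multiples of a common `e_k` (if `p_k ≠ 0` then `q, r ∈ K·p̂` and
  `-2 p_m q_k r_k / p_k = 0` for `m ≠ k`).
* `le_cross_of_column_three`: if moreover `k = 3`, then `W ≤ X₃₃ = {support ⊂ row 3 ∪ column 3}`
  (the CROSS): `{x ∈ W : row_3 x = 0} = ⟨E₀₃, E₁₃, E₂₃⟩` by dimension, and the cubic on rows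
  `(a, b, 3)` of `α E_{a3} + x` gives the pairings of `(x_{b0}, x_{b1}, x_{b2})` with
  `(x_{30}, x_{31}, x_{32})`, which on the sections `row_3 x = e_m` and their sums force
  `x_{bj} = 0` (`b, j < 3`).
General position (any full row or column, any `k`) is `SymPencilBoxFourCrossOf`. [folklore]
-/

noncomputable section

-- single-conjunct layout: Sub = Summit, duplicated namespace component intended
set_option linter.dupNamespace false

namespace Summit.ValiantsHypothesis.ValiantsHypothesis.Theorems.SymPencilBoxFourCross

open Module Finset
open Literature.Computability.AlgebraicComplexity
open Literature.Computability.AlgebraicComplexity.AlperBogartVelasco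

variable {K : Type*} [Field K]

/-- **Three single-row elements over a full row share a column.**  See the module docstring.
[folklore] -/
theorem exists_common_column [CharZero K] (W : Submodule K (Fin 4 × Fin 4 → K))
    (hW : ∀ x ∈ W, ∀ (r c : Fin 3 → Fin 4), Function.Injective r → Function.Injective c →
      ((Matrix.of fun i j => x (i, j)).submatrix r c).permanent = 0)
    (hR : finrank K ↥(W.map (LinearMap.funLeft K K fun j : Fin 4 => ((3 : Fin 4), j))) = 4)
    (hz : ∀ a : Fin 4, a ≠ 3 → ∃ z ∈ W, z ≠ 0 ∧ ∀ i, i ≠ a → ∀ j, z (i, j) = 0) :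
    ∃ k : Fin 4, ∀ a : Fin 4, a ≠ 3 → ∃ z ∈ W, z (a, k) ≠ 0 ∧ ∀ p, p ≠ (a, k) → z p = 0 := by
  have hcases : ∀ i : Fin 4, i = 0 ∨ i = 1 ∨ i = 2 ∨ i = 3 := by decide
  have e00 : (0 : Fin 4).succAbove 0 = 1 := by decide
  have e01 : (0 : Fin 4).succAbove 1 = 2 := by decide
  have e02 : (0 : Fin 4).succAbove 2 = 3 := by decide
  have e10 : (1 : Fin 4).succAbove 0 = 0 := by decide
  have e11 : (1 : Fin 4).succAbove 1 = 2 := by decide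
  have e12 : (1 : Fin 4).succAbove 2 = 3 := by decide
  have e30 : (3 : Fin 4).succAbove 0 = 0 := by decide
  have e31 : (3 : Fin 4).succAbove 1 = 1 := by decide
  have e32 : (3 : Fin 4).succAbove 2 = 2 := by decide
  let T : Fin 4 → (Fin 4 → K) → (Fin 4 → K) → (Fin 4 → K) → K := fun c u v w =>
    u (c.succAbove 0) * (v (c.succAbove 1) * w (c.succAbove 2) + v (c.succAbove 2) * w (c.succAbove 1)) +
    u (c.succAbove 1) * (v (c.succAbove 0) * w (c.succAbove 2) + v (c.succAbove 2) * w (c.succAbove 0)) +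
    u (c.succAbove 2) * (v (c.succAbove 0) * w (c.succAbove 1) + v (c.succAbove 1) * w (c.succAbove 0))
  let ρ : Fin 4 → (Fin 4 × Fin 4 → K) →ₗ[K] (Fin 4 → K) :=
    fun r => LinearMap.funLeft K K fun j => (r, j)
  have hρ : ∀ r x j, ρ r x j = x (r, j) := fun _ _ _ => rfl
  have hF : ∀ y ∈ W, ∀ r₀ r₁ r₂ : Fin 4, r₀ ≠ r₁ → r₀ ≠ r₂ → r₁ ≠ r₂ → ∀ c : Fin 4,
      T c (ρ r₀ y) (ρ r₁ y) (ρ r₂ y) = 0 := by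
    intro y hy r₀ r₁ r₂ h01 h02 h12 c
    have hinj : Function.Injective ![r₀, r₁, r₂] := by
      intro a b hab
      fin_cases a <;> fin_cases b <;> simp_all
    have h := hW y hy ![r₀, r₁, r₂] c.succAbove hinj Fin.succAbove_right_injective
    rw [Matrix.permanent_fin_three_row] at h
    simp only [Matrix.submatrix_apply, Matrix.of_apply, Matrix.cons_val_zero, Matrix.cons_val_one,
      Matrix.cons_val] at h
    simp only [T, hρ]
    linear_combination h
  -- pairings from the vanishing of `T_c(y, w, t)` for all `t` (free vector last)
  have pairing : ∀ (y w : Fin 4 → K), (∀ (t : Fin 4 → K) (c : Fin 4), T c y w t = 0) →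
      ∀ l l' : Fin 4, l ≠ l' → y l * w l' + y l' * w l = 0 := by
    intro y w h l l' hll'
    have t01 := h (Pi.single 2 1) 3
    have t02 := h (Pi.single 1 1) 3
    have t12 := h (Pi.single 0 1) 3
    have t13 := h (Pi.single 2 1) 0
    have t23 := h (Pi.single 1 1) 0
    have t03 := h (Pi.single 2 1) 1
    simp only [T, e00, e01, e02, e10, e11, e12, e30, e31, e32,
      Pi.single_apply] at t01 t02 t12 t13 t23 t03
    simp only [show ((0 : Fin 4) = 2) = False by decide, show ((1 : Fin 4) = 2) = False by decide,
      show ((3 : Fin 4) = 2) = False by decide, show ((0 : Fin 4) = 1) = False by decide,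
      show ((2 : Fin 4) = 1) = False by decide, show ((3 : Fin 4) = 1) = False by decide,
      show ((1 : Fin 4) = 0) = False by decide, show ((2 : Fin 4) = 0) = False by decide,
      if_true, if_false, mul_zero, mul_one, zero_add, add_zero] at t01 t02 t12 t13 t23 t03
    rcases hcases l with rfl | rfl | rfl | rfl <;> rcases hcases l' with rfl | rfl | rfl | rfl <;>
      first
      | exact absurd rfl hll'
      | linear_combination t01
      | linear_combination t02
      | linear_combination t12
      | linear_combination t13
      | linear_combination t23
      | linear_combination t03
  -- row `3` is onto
  have hsurj : ∀ t : Fin 4 → K, ∃ x ∈ W, ρ 3 x = t := by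
    intro t
    have htop : W.map (ρ 3) = ⊤ := by
      apply Submodule.eq_top_of_finrank_eq
      rw [finrank_fintype_fun_eq_card, Fintype.card_fin]
      exact hR
    have ht : t ∈ W.map (ρ 3) := by rw [htop]; exact Submodule.mem_top
    obtain ⟨x, hx, hxt⟩ := ht
    exact ⟨x, hx, hxt⟩
  -- the three single-row elements and their rows
  obtain ⟨z0, hz0W, hz0, hz0r⟩ := hz 0 (by decide)
  obtain ⟨z1, hz1W, hz1, hz1r⟩ := hz 1 (by decide)
  obtain ⟨z2, hz2W, hz2, hz2r⟩ := hz 2 (by decide)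
  -- the rows of `z_a, z_b` are unpaired: coefficient of `αβ` in the cubic on rows `(a, b, 3)`
  have hunp : ∀ (a b : Fin 4) (za zb : Fin 4 × Fin 4 → K), a ≠ b → a ≠ 3 → b ≠ 3 →
      za ∈ W → zb ∈ W → (∀ j, za (b, j) = 0) → (∀ j, za (3, j) = 0) →
      (∀ j, zb (a, j) = 0) → (∀ j, zb (3, j) = 0) →
      ∀ l l' : Fin 4, l ≠ l' → za (a, l) * zb (b, l') + za (a, l') * zb (b, l) = 0 := by
    intro a b za zb hab ha3 hb3 hzaW hzbW hab0 ha30 hba0 hb30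
    refine pairing (ρ a za) (ρ b zb) (fun t c => ?_)
    obtain ⟨x, hxW, hxt⟩ := hsurj t
    have h11 := hF (za + zb + x) (W.add_mem (W.add_mem hzaW hzbW) hxW) a b 3 hab ha3 hb3 c
    have h10 := hF (za + x) (W.add_mem hzaW hxW) a b 3 hab ha3 hb3 c
    have h01 := hF (zb + x) (W.add_mem hzbW hxW) a b 3 hab ha3 hb3 c
    have h00 := hF x hxW a b 3 hab ha3 hb3 c
    rw [← hxt]
    simp only [T, hρ, Pi.add_apply, hab0, ha30, hba0, hb30, zero_add, add_zero] at h11 h10 h01 h00 ⊢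
    linear_combination h11 - h10 - h01 + h00
  have P01 := hunp 0 1 z0 z1 (by decide) (by decide) (by decide) hz0W hz1W
    (fun j => hz0r 1 (by decide) j) (fun j => hz0r 3 (by decide) j)
    (fun j => hz1r 0 (by decide) j) (fun j => hz1r 3 (by decide) j)
  have P02 := hunp 0 2 z0 z2 (by decide) (by decide) (by decide) hz0W hz2W
    (fun j => hz0r 2 (by decide) j) (fun j => hz0r 3 (by decide) j)
    (fun j => hz2r 0 (by decide) j) (fun j => hz2r 3 (by decide) j)
  have P12 := hunp 1 2 z1 z2 (by decide) (by decide) (by decide) hz1W hz2W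
    (fun j => hz1r 2 (by decide) j) (fun j => hz1r 3 (by decide) j)
    (fun j => hz2r 1 (by decide) j) (fun j => hz2r 3 (by decide) j)
  -- the rows `p, q, r` are non-zero
  have hrow : ∀ (a : Fin 4) (z : Fin 4 × Fin 4 → K), z ≠ 0 → (∀ i, i ≠ a → ∀ j, z (i, j) = 0) →
      ∃ k, z (a, k) ≠ 0 := by
    intro a z hz hzr
    by_contra h
    push Not at h
    apply hz
    funext ⟨i, j⟩
    by_cases hi : i = a
    · rw [hi]; exact h j
    · exact hzr i hi j
  obtain ⟨k, hk⟩ := hrow 0 z0 hz0 hz0r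
  -- `q_m p_k = -p_m q_k`, `r_m p_k = -p_m r_k`
  have hq : ∀ m, m ≠ k → z0 (0, k) * z1 (1, m) = -(z0 (0, m) * z1 (1, k)) := fun m hm => by
    linear_combination P01 k m (Ne.symm hm)
  have hr : ∀ m, m ≠ k → z0 (0, k) * z2 (2, m) = -(z0 (0, m) * z2 (2, k)) := fun m hm => by
    linear_combination P02 k m (Ne.symm hm)
  have hqk : z1 (1, k) ≠ 0 := by
    intro h0
    obtain ⟨m, hm⟩ := hrow 1 z1 hz1 hz1r
    by_cases hmk : m = k
    · rw [hmk] at hm; exact hm h0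
    · have := hq m hmk
      rw [h0, mul_zero, neg_zero] at this
      exact hm ((mul_eq_zero.1 this).resolve_left hk)
  have hrk : z2 (2, k) ≠ 0 := by
    intro h0
    obtain ⟨m, hm⟩ := hrow 2 z2 hz2 hz2r
    by_cases hmk : m = k
    · rw [hmk] at hm; exact hm h0
    · have := hr m hmk
      rw [h0, mul_zero, neg_zero] at this
      exact hm ((mul_eq_zero.1 this).resolve_left hk)
  -- `p_m = 0` off `k`, hence `q_m = r_m = 0` off `k`
  have hp0 : ∀ m, m ≠ k → z0 (0, m) = 0 := by
    intro m hm
    have h3 := P12 k m (Ne.symm hm)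
    have h2 : (2 : K) * (z0 (0, k) * z0 (0, m) * z1 (1, k) * z2 (2, k)) = 0 := by
      linear_combination (z0 (0, k) * z2 (2, k)) * hq m hm + (z0 (0, k) * z1 (1, k)) * hr m hm -
        (z0 (0, k)) ^ 2 * h3
    have h4 := (mul_eq_zero.1 h2).resolve_left two_ne_zero
    simp only [mul_eq_zero] at h4
    rcases h4 with ((h | h) | h) | h
    · exact absurd h hk
    · exact h
    · exact absurd h hqk
    · exact absurd h hrk
  have hq0 : ∀ m, m ≠ k → z1 (1, m) = 0 := fun m hm => by
    have := hq m hm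
    rw [hp0 m hm, zero_mul, neg_zero] at this
    exact (mul_eq_zero.1 this).resolve_left hk
  have hr0 : ∀ m, m ≠ k → z2 (2, m) = 0 := fun m hm => by
    have := hr m hm
    rw [hp0 m hm, zero_mul, neg_zero] at this
    exact (mul_eq_zero.1 this).resolve_left hk
  refine ⟨k, fun a ha => ?_⟩
  have single : ∀ (a : Fin 4) (z : Fin 4 × Fin 4 → K), (∀ i, i ≠ a → ∀ j, z (i, j) = 0) →
      (∀ m, m ≠ k → z (a, m) = 0) → ∀ p : Fin 4 × Fin 4, p ≠ (a, k) → z p = 0 := by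
    rintro a z hzr hzm ⟨i, j⟩ hp
    by_cases hi : i = a
    · subst hi
      have hj : j ≠ k := fun hj => hp (by rw [hj])
      exact hzm j hj
    · exact hzr i hi j
  rcases hcases a with rfl | rfl | rfl | rfl
  · exact ⟨z0, hz0W, hk, single 0 z0 hz0r hp0⟩
  · exact ⟨z1, hz1W, hqk, single 1 z1 hz1r hq0⟩
  · exact ⟨z2, hz2W, hrk, single 2 z2 hz2r hr0⟩
  · exact absurd rfl ha

end Summit.ValiantsHypothesis.ValiantsHypothesis.Theorems.SymPencilBoxFourCross

end
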